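import Summits.ResolutionOfSingularities.ResolutionOfSingularities.Theorems.PurelyInseparableDim4ResConeLightTripleEntry
import HarnessLib
import HarnessLib.Audit.Tags

/-!
# Purely inseparable four-folds — the LIGHT-PAIR ENTRY: two stretch-born boundary letters give the pair-merged
# Hasse ledger `U·G = S·x_a x_a′ + T·H^d` (K2(p) lane, slice B, entry object of the C∞ regime; cell `res-dim4-pi`)

[OURS · counted 0 · cell `res-dim4-pi` · K2(p) lane (holder res-dim4-p-12 g3); the two-letter analogue of
res-dim4-p-2 g4's K25d `no_light_triple_regime_of_born` entry construction, seat res-dim4-p-2 g4 (offer K28 (c)).]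
Nothing here proves K2(p)/K2(5), `NoIsolatedTrap p p` or resolution of singularities in dimension ≥ 4 /
characteristic `p`; this is the ENTRY OBJECT of the C∞ (two-slot) kernel game, nothing about its play.  AI kernel
work, weaker than expert review.

**`pair_hasse_ledger_of_born`** (every `p`, `2 ≤ d < p`): on a power-cone stretch with frame data, two DISTINCT
boundary letters `a, a′` at a stage `k`, each stretch-born and kept since its birth (idea-4 g3's `Born`:
`∃ t, k₀ ≤ t < k, j t = a, ∀ m ∈ (t, k), j m ≠ a ∧ b m a = 0`), carry the PAIR-MERGED HASSE LEDGER: a third letter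
`e ∉ {a, a′}` carrying the vertex form (res-dim4-typ-1 g2's K13b `contactSupport_not_subset_pair`), the two generic
one-letter ledgers (res-dim4-p-2 g3's K11 `stretch_ledger`), their conversion to the COMMON contact polynomial
`H = D_e^{(d−1)} G` (res-dim4-p-12 g3's K8 `exists_unit_mul_mem_span_X_hasseDeriv_pow_of_mem`) and the UFD merge
(K2 `mem_span_mul_of_mem_span_of_mem_span`, `H ∉ (x_a, x_a′)` by `hasseDeriv_powerCone_not_mem_span_X_pair`):
`U·G_k = S·(x_a x_a′) + T·H^d`, `U(0) ≠ 0`, `H ∈ 𝔪₀`, `lin H = (a₀ d ℓ_e^{d−1})·L_k` EXACT (res-dim4-p-3 g3's K16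
`homogeneousComponent_one_hasseDeriv_powerCone`), hence `ord S ≥ d − 1` and `T(0)·κ^d = U(0)·a₀` (K16
`levelTwo_seed`).
bears_on: LADDER-RESOLUTION:D157-DOOR2 (res-dim4-pi · K2(p) · slice B · C∞ entry).  Supports
stmt-ResolutionOfSingularities-16155 (helper).
-/

set_option linter.dupNamespace false -- mandated namespace of this single-conjunct summit

noncomputable section

namespace Summit.ResolutionOfSingularities.ResolutionOfSingularities.Theorems.PIDim4

namespace ResCone

open MvPolynomial Finset
open Literature.AlgebraicGeometry.Resolution
open Literature.AlgebraicGeometry.Resolution.CentreBlowup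
open Literature.AlgebraicGeometry.Resolution.Hauser2010
open Literature.AlgebraicGeometry.Resolution.HauserPerlega2019
open PointBlowup (polarMap additiveSubspace direction)

variable {K : Type} [Field K]

section Chain

variable (p : ℕ) [hp : Fact p.Prime] [CharP K p] [DecidableEq K]

/-- **THE PAIR-MERGED HASSE LEDGER OF TWO STRETCH-BORN LETTERS** (statement in the module docstring). [OURS]
[cite: CossartJannsenSaito2020, Thm. 3.10(4), Thm. 3.14] -/
theorem pair_hasse_ledger_of_born {c : ℕ → State K} {j : ℕ → Fin 4} {b : ℕ → Fin 4 → K}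
    (hc : ∀ k, IsIsolated p (c k).F ∧ Step0 p (c k) (c (k + 1))) (hw : FreeTail.IsWitnessedChain p c j b)
    (hr0 : ∀ e ∈ (c 0).F.support, (c 0).r ≤ e) (hfloor : ∀ k, ordZero (c k).F ≠ p) {k₀ d : ℕ} (hd2 : 2 ≤ d)
    (hdp : d < p) (hshade : ∀ k, k₀ ≤ k → (c k).shade = (d : ℕ∞)) {ℓ : ℕ → Fin 4 → K} {a0 lam : ℕ → K}
    (hform : ∀ k, k₀ ≤ k → resForm (c k) = C (a0 k) * (∑ i, C (ℓ k i) * X i) ^ d)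
    (hdir : ∀ k, k₀ ≤ k → ℓ k (j k) + dotProduct (ℓ k) (b k) = 0) (hlam : ∀ k, k₀ ≤ k → lam k ≠ 0)
    (hprop : ∀ k, k₀ ≤ k → ∀ i, i ≠ j k → ℓ (k + 1) i = lam k * ℓ k i)
    (hcarry : ∀ k, k₀ ≤ k → ∃ i, i ≠ j k ∧ ℓ k i ≠ 0) {k : ℕ} {a a' : Fin 4} (haa : a ≠ a')
    {ta ta' : ℕ} (hta : k₀ ≤ ta) (htak : ta < k) (hja : j ta = a)
    (hkepta : ∀ m, ta < m → m < k → j m ≠ a ∧ b m a = 0) (hta' : k₀ ≤ ta') (hta'k : ta' < k)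
    (hja' : j ta' = a') (hkepta' : ∀ m, ta' < m → m < k → j m ≠ a' ∧ b m a' = 0) :
    ∃ (e : Fin 4) (U S T : MvPolynomial (Fin 4) K), e ≠ a ∧ e ≠ a' ∧ ℓ k e ≠ 0 ∧
      1 ≤ (c k).r a ∧ 1 ≤ (c k).r a' ∧ MvPolynomial.eval (0 : Fin 4 → K) U ≠ 0 ∧
      hasseDeriv (Finsupp.single e (d - 1)) ((c k).F.divMonomial (c k).r) ∈ originIdeal K ∧
      homogeneousComponent 1 (hasseDeriv (Finsupp.single e (d - 1)) ((c k).F.divMonomial (c k).r)) =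
        C (a0 k * d * ℓ k e ^ (d - 1)) * (∑ i, C (ℓ k i) * X i) ∧
      U * ((c k).F.divMonomial (c k).r) =
        S * (X a * X a') + T * hasseDeriv (Finsupp.single e (d - 1)) ((c k).F.divMonomial (c k).r) ^ d ∧
      (∀ m ∈ S.support, d - 1 ≤ m.degree) ∧
      MvPolynomial.eval 0 T * (a0 k * d * ℓ k e ^ (d - 1)) ^ d = MvPolynomial.eval 0 U * a0 k := by
  classical
  have hd1 : 1 ≤ d := by omega
  have hk : k₀ ≤ k := hta.trans htak.le
  have hbj : ∀ k, b k (j k) = 0 := fun k => (hw k).2.1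
  -- a third letter carrying the vertex form (K13b, either birth order)
  obtain ⟨e, hea, hea', hℓe⟩ : ∃ e, e ≠ a ∧ e ≠ a' ∧ ℓ k e ≠ 0 := by
    subst hja; subst hja'
    rcases lt_trichotomy ta ta' with hlt | heq | hgt
    · exact contactSupport_not_subset_pair hdir hlam hprop hcarry hbj hta hlt hta'k hkepta hkepta'
    · exact absurd (congrArg j heq) haa
    · obtain ⟨m, h1, h2, h3⟩ := contactSupport_not_subset_pair hdir hlam hprop hcarry hbj hta' hgt htak hkepta' hkepta
      exact ⟨m, h2, h1, h3⟩
  -- the residual at `k` and its cone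
  obtain ⟨o, ho, hpo, -, hod⟩ := chain_shade_nat p hc hfloor hshade hk
  have hr := IsolatedBand.isolated_chain_forall_le hc hr0 k
  set G := (c k).F.divMonomial (c k).r with hGdef
  have hcone : homogeneousComponent d G = C (a0 k) * (∑ i, C (ℓ k i) * X i) ^ d := by
    have h1 := hform k hk
    rw [resForm_eq_homogeneousComponent_divMonomial ho hr, hod] at h1
    exact h1
  have ha₀ : a0 k ≠ 0 := ne_zero_of_resForm_eq_C_mul ho hr (hform k hk)
  have hordG : ∀ m ∈ G.support, d ≤ m.degree := by
    rw [hGdef, ← hod]; exact forall_le_degree_divMonomial ho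
  -- the two generic ledgers (K11)
  obtain ⟨-, hra, ua, ha, hua, hha, hcoefa, hGa⟩ := stretch_ledger p hc hw hr0 hfloor hd1 hshade hform hdir hlam
    hprop hcarry hta htak hja.symm hkepta
  obtain ⟨-, hra', ua', ha', hua', hha', hcoefa', hGa'⟩ := stretch_ledger p hc hw hr0 hfloor hd1 hshade hform hdir
    hlam hprop hcarry hta' hta'k hja'.symm hkepta'
  -- the COMMON Hasse letter `e` (K8)
  have hwit : coeff (Finsupp.single e d) G ≠ 0 := by
    rw [show coeff (Finsupp.single e d) G = coeff (Finsupp.single e d) (homogeneousComponent d G) by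
      rw [coeff_homogeneousComponent, Finsupp.degree_single, if_pos rfl], hcone, coeff_C_mul,
      coeff_single_pow_linearForm]
    exact mul_ne_zero ha₀ (pow_ne_zero _ hℓe)
  set H := hasseDeriv (Finsupp.single e (d - 1)) G with hHdef
  obtain ⟨va, hva, hHa⟩ := IsolatedBand.exists_unit_mul_mem_span_X_hasseDeriv_pow_of_mem p hea hd1 hdp hha hGa
    hua (by rw [IsolatedBand.eval_hasseDeriv_single_one]; exact hcoefa e hea hℓe) hordG
    (Finsupp.single_eq_of_ne hea.symm) (Finsupp.degree_single e d) hwit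
  obtain ⟨va', hva', hHa'⟩ := IsolatedBand.exists_unit_mul_mem_span_X_hasseDeriv_pow_of_mem p hea' hd1 hdp hha'
    hGa' hua' (by rw [IsolatedBand.eval_hasseDeriv_single_one]; exact hcoefa' e hea' hℓe) hordG
    (Finsupp.single_eq_of_ne hea'.symm) (Finsupp.degree_single e d) hwit
  -- the merge (K2)
  have hHaa : H ∉ Ideal.span {(X a : MvPolynomial (Fin 4) K), X a'} :=
    IsolatedBand.hasseDeriv_powerCone_not_mem_span_X_pair p hea hea' hd1 hdp ha₀ hℓe hcone
  set U := va * va' with hUdef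
  have hUa : U * G ∈ Ideal.span {(X a : MvPolynomial (Fin 4) K), H ^ d} := by
    rw [show U * G = va' * (va * G) by rw [hUdef]; ring]; exact Ideal.mul_mem_left _ _ hHa
  have hUa' : U * G ∈ Ideal.span {(X a' : MvPolynomial (Fin 4) K), H ^ d} := by
    rw [show U * G = va * (va' * G) by rw [hUdef]; ring]; exact Ideal.mul_mem_left _ _ hHa'
  obtain ⟨S, T, hST⟩ := Ideal.mem_span_pair.mp (IsolatedBand.mem_span_mul_of_mem_span_of_mem_span haa hHaa hUa hUa')
  have hU : MvPolynomial.eval (0 : Fin 4 → K) U ≠ 0 := by rw [hUdef, map_mul]; exact mul_ne_zero hva hva'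
  have hlinH : homogeneousComponent 1 H = C (a0 k * d * ℓ k e ^ (d - 1)) * (∑ i, C (ℓ k i) * X i) :=
    homogeneousComponent_one_hasseDeriv_powerCone e hd1 hcone
  have hHm : H ∈ originIdeal K := IsolatedBand.hasseDeriv_single_mem_originIdeal e hd2 hordG
  have hG : U * G = S * (X a * X a') + T * H ^ d := hST.symm
  -- the level-2 seed (K16)
  obtain ⟨hS, hT⟩ := levelTwo_seed hd2 hG hHm hordG hcone hlinH hea' hℓe
  exact ⟨e, U, S, T, hea, hea', hℓe, hra, hra', hU, hHm, hlinH, hG, hS, hT⟩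

end Chain

end ResCone

end Summit.ResolutionOfSingularities.ResolutionOfSingularities.Theorems.PIDim4

end
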